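import Summits.QuantumFields.YangMills.Theorems.UnitScaleTiltHalvingP1FlatCoreSupplierTopCallTraceFreeGamma
import Literature.MathematicalPhysics.QuantumFieldTheory.Balaban1983to89.B8CubeMemberLamBPrimeLaws
import Literature.MathematicalPhysics.QuantumFieldTheory.Balaban1983to89.B8LeafKnitZd3CubBdryBeta
import Literature.MathematicalPhysics.QuantumFieldTheory.Balaban1983to89.B8Ineq133CubeMemberGamma
import Summits.QuantumFields.YangMills.Theorems.UnitScaleTiltHalvingP1FlatCoreSupplierInduction
import Summits.QuantumFields.YangMills.Theorems.UnitScaleTiltHalvingP1FlatCoreTopTargetRep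
import Literature.MathematicalPhysics.QuantumFieldTheory.Balaban1983to89.B8SockHFPCubeMember
import Literature.MathematicalPhysics.QuantumFieldTheory.Balaban1983to89.B8Prop6OfThm4
import HarnessLib

/-!
# `hP1room` PROGRAMME (LEAD-H thin ROAD γ, WORD 21 (γ-2b)), ★★★ THE TOP-STEP ROWS OF ONE SITE FROM THE SOCKETS, EDITION γ — ✓p654110
# `HalvingHSiteTopRowsOfSockets.siteTopRows_of_sockets` with its (1.59) in-edge re-read in pub-ymgap's currency of record: the vacuous b9 socket `SB9 : SockB9P3 … (cubeLamB …)` at level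
# `m` REPLACED by Theorem 4's own two-member clause `H59Dβm` for the datum, β-shaped index over PRINT's split class `cubeLamBP'` ∪ the level-0 crossing bonds of `□₀`, with the
# exterior-collar allowance; the call re-pointed to ✓p678434 `topRows_of_datum_traceFree_γ`

Route `UnitScaleTilt`, crux K1 child «MinimiserStabilityRegPr» (stmt-QuantumFields-19200), registered stub `stub_halvingStep` (`BirthV10`).  Cell `ym3-torus` (HUMAN RULING D-0037:
YM₃ on T³ is ladder rung R3 — NOT d = 4, NOT a mass gap, NOT the Clay problem), width seat `ym-ust-19200-w3` gen 9.  `--supports stmt-QuantumFields-19200 --as helper`; THEOREMS ONLY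
(0 `def`, 0 `sorry`); count-neutral; nothing here claims `hMember`, `hSupUρ4`, the stub, the crux or the gap.

WHY (LEAD-H WORDs 13–21, ★★OWNER RULING g28-№11, 2026-08-28).  ✓p654110 reads the b9 edge as lit `SockB9P3` at the class `cubeLamB` — KERNEL-VACUOUS at the cell's cube members (lit
✓`B9SupplySockB9P3ZdSocketBoundaryMode`, ✓`B8Ineq159FlatShellModeVacuity`, ★w7-19200 g6's certificate).  Edition γ (pub-ymgap, lit ✓`B9SupplySockB9P3ZdGamma`, ✓`B8Thm4KLevelGamma`,
✓`B8SockHFP59Gamma`) reads the β-shaped socket at PRINT's class (crossing bonds at every level, box law «box ⊂ Ω_{j−1}»), Theorem 4's datum carrying the SUPPORT clause, (1.35) in the same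
guard, [3] Prop. 4's windows one level lower.  THIS FILE is ✓p654110 in that currency.
WHAT.  `h135_cubeMember_γ` (J3's tower row (d) ⇒ the datum's (1.35) in the γ guard, lit ✓`bondBox_subset_tcube_of_subset_cubeFam` at `j′ := j − 1`); ★★★ `siteTopRows_of_sockets_γ` —
✓p654110's binders VERBATIM except: the class `Λb := cubeLamBP' P.L a M′ ρ′ (m + 1)` (lit ✓`B9SupplySockB9P3ZdGamma.cubeLamBP'`; laws lit ✓`B8CubeMemberLamBPrimeLaws.cubeLamBP'_hbox_pred` ∕
`cubeLamBP'_hclass`); `SB9 hα₀9 hcs9` ↦ Theorem 4's two-member clause `H59Dβm` for the datum at the flat background (index `cubeLamBP' … m j ∪ {level-0 CrossB □₀}`, `+ Bbd·Φ₀(A′)`) +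
`{Bbd} (hBbd : 0 ≤ Bbd) (hBd : 4·Bbd ≤ (dL − 1)·B₀)`; the datum carries `hu₁S : u₁ = 1 off □₀` (Theorem 4's `u` is supported in `Ω₀` — lit ✓`B8Thm4SupportLocal`); `hC₂ ↦` the γ remainder
shape; PLUS the γ windows `hα3γ hα4γ h16γ hsmallγ hc₃γ`.  Discharged inside (as in ✓p654110): member laws (lit ✓`hΩ_cubeFam`, `cubeLamBP'_hbox_pred`, `cubeLamBP'_hclass`, `htw_cubeLamS`,
`h8lt_cubeLamS`, `h8top_cubeLamS`), flat (1.33), J3's rows ↦ `h34 hAx`, (1.35) in the γ guard (`h135_cubeMember_γ`), (1.66)₀ off the tower row at depth `m + 1`, the boundary-layer law (lit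
✓`B8LeafKnitZd3CubBdryBeta.bdryLayer_cubeMember`), the representative law (✓`hrep_cubeLamS`).  CONCLUSION = ✓p654110's eight conjuncts UNCHANGED.
A6 GUARD (LEAD rule, WORD 17): `H59Dβm` is CONSUMED here at the exact triple (β-shaped two-line clause of `SockB9P3D4β`, class `cubeLamBP'`, truncation `m`); = print's (1.59)∕[4] Thm 3.3
for `G(1)` on the finite cube family with exterior data; at the FLAT background it is lit's `Ineq159FlatCubeMemberPrinted`-class statement (lit ✓`B8Ineq159FlatCubeMemberTransplantL3`,
✓`B8Prop6CubeMemberScalarGammaOfIneq159Printed` — ★w7-19200 g6's «`U₀ = 1` discharge» LOCATE decides whether the caller displays it or proves it); A6-witnessed at truncation 0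
(`…nonvacuous_cubeLamBP'_zero`); NOT inhabited by the shell∕collar modes (crossing bonds present).  No satisfiability claim here.
HONEST SCOPE.  By-name plumbing; the letters, the clause, the windows and the torus rows are DISPLAYED hypotheses; nothing of [4], Prop. 3∕5, Theorem 4, `hMember` or the stub is proved.
Rung R3 (YM₃ on T³), NOT Clay; YM gap NOT proved.

References: T. Bałaban, CMP **99** (1985) 75–102 [Balaban1985RegularSpaces] (Prop. 5 (1.106)–(1.109) p.94, Thm 4 p.88, (1.66)–(1.69) p.88, (1.31) p.82, (1.131)–(1.133) p.99, p.77, p.76);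
CMP **99** (1985) 389–434 [Balaban1985BackgroundPropagators] (Thm 3.1 p.397, (3.25) p.394, Thm 3.3 p.399, (3.16) p.393); CMP **96** (1984) 223–250 [Balaban1984PropagatorsII] ((2.3) p.224);
CMP **98** (1985) 17–51 [Balaban1985Averaging] (p.20, (208)–(214) p.50).
-/

set_option autoImplicit false

noncomputable section

open scoped BigOperators
open NormedSpace
open Complex (I)

namespace Summit.QuantumFields.YangMills.Theorems.HalvingHSiteTopRowsOfSocketsGamma

open Literature.MathematicalPhysics.QuantumFieldTheory.Balaban1983to89
open T4Continuum
open MatrixLog (mlog)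
open B5Eq118OneStroke (iterBlockOf)
open B7Prop1Explicit (Site e expUnit)
open B7Prop2Explicit (unitaryUnits C0 c2' avgIter AvgClosed)
open B7Prop3Flat (c3)
open B7Prop10General (C6 C4G)
open B7Prop9Flat (C5')
open B7Prop1Local (InBox loK bondHiK)
open B7Eq78Linearization (conjR zdBlocking QprimeIter)
open B7Eq92Concrete (mgauge)
open B8Ineq130 (tlo thi)
open B8Ineq132 (covDerivFwd InAk)
open B8Eq119TwistedAxial (Restr129 InAx bgT)
open B8Eq131Cubes (gs tLo tHi)
open B8Eq131CubesAdmissible (cubeFam)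
open B8CubeMemberZd (cubeLamS cubeLamB hΩ_cubeFam hbox_cubeLamB hclass_cubeLamB)
open B8SockHFPCubeMember (htw_cubeLamS h8lt_cubeLamS h8top_cubeLamS)
open B8Eq184Proof (gaugeExp cfgExp)
open B8Eq182Proof (gAd)
open B8Eq188Proof (frakF3)
open B8Eq140Level (SideTouches)
open B8Eq138LandauZd (IsLandau138W covDivB covLap QT)
open B8Ineq125Concrete (C2p)
open B8Eq1117Concrete (XSpace)
open B8Prop5ContractionKLevel (Bd2 Mc Kc)
open B8LambdaSpaceKLevel (wt)
open B8Eq178Averages (Qnl)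
open B8Prop6OfThm4 (one_inAk)
open B10Eq27TorusAxialLog (rel axialT)
open B15Eq112TorusCover (lift cover)
open Node00 (coverAt)
open LatticeFieldCalculus (siteAvgIter)
open Summit.QuantumFields.YangMills.Theorems.Prop8ChartDoubleBar (dbarIterU)
open HalvingP1FlatCoreSupplierTopCallTraceFreeGamma (topRows_of_datum_traceFree_γ)
open B9SupplySockB9P3ZdBeta (CrossB)
open B8Lemma1NonAbelian (mulCfg)
open B9SupplySockB9P3ZdGamma (cubeLamBP')
open B8CubeMemberLamBPrimeLaws (cubeLamBP'_hbox_pred cubeLamBP'_hclass)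
open B8LeafKnitZd3CubBdryBeta (bdryLayer_cubeMember)
open B8Ineq133CubeMemberGamma (ends_inBox_tilde_of_bondBox_subset_tcube bondBox_subset_tcube_of_subset_cubeFam)
open B8Ineq132 (BondTouches)
open B7Prop4GeneralLevels (linCovIter)
open B8Eq155JBound (Jcur wsup)
open B8ScaledSupNorm (bondNorm msup)
open B8Eq146AExpansion (iEta)
open B8Eq131Cubes (collar_cube)
open B8Eq131CubesAdmissible (cubeFam_false_of_le)
open HalvingP1FlatCoreSupplierInduction (ends_of_sideTouches)
open HalvingP1FlatCoreSupplierInduction (h34_of_inAk_univ hAx_of_inAx_one h135_cubeMember)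
open P1FlatCoreTopTargetRep (hrep_cubeLamS)

variable {P : Params} {𝔸 : Type*} [CStarAlgebra 𝔸] [Nontrivial 𝔸]

/-! ## §0 The datum's (1.35) in PRINT's guard «box ⊂ Ω_{j−1}» from J3's tower row (d) -/

omit [Nontrivial 𝔸] in
/-- **THE DATUM's (1.35) IN THE γ GUARD AT THE CUBE MEMBER FROM J3 (d)**: a level-`j` bond whose fine box lies in `□_{j−1}` (`⊂ □̃`) has its ends in the depth-`(k − j)` tower box
of `□̃` (lit ✓`B8Ineq133CubeMemberGamma.bondBox_subset_tcube_of_subset_cubeFam` at `j′ := j − 1` + `ends_inBox_tilde_of_bondBox_subset_tcube`), where the tower row bounds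
`‖Ū′ʲ − 1‖`. [cite: Balaban1985RegularSpaces, (1.35) p.82, (1.31) p.82, (1.65)-(1.66) p.87, (1.133) p.99] -/
theorem h135_cubeMember_γ {L : ℕ} (hL : 2 ≤ L) (aC : Site P.d) (M : ℕ) {ρ : ℕ} (hρ1 : 1 ≤ ρ) {k : ℕ} {α₁ : ℝ} {U' : Site P.d → Fin P.d → 𝔸ˣ}
    (htw : ∀ m, m ≤ k → ∀ (x : Site P.d) (ν : Fin P.d), tlo L (tLo aC ρ) m ≤ x → x + e ν ≤ thi L (tHi aC M ρ) m →
      ‖((avgIter L U' (k - m) x ν : 𝔸ˣ) : 𝔸) - 1‖ < α₁) :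
    ∀ j, j ≤ k → ∀ (z : Site P.d) (μ : Fin P.d), (∀ x, InBox (loK L j z) (bondHiK L j z μ) x → x ∈ cubeFam false L aC M ρ k (j - 1)) →
      ‖(avgIter L (mulCfg U' (1 : Site P.d → Fin P.d → 𝔸ˣ)) j z μ : 𝔸) - (avgIter L (1 : Site P.d → Fin P.d → 𝔸ˣ) j z μ : 𝔸)‖ ≤ α₁ := by
  have hL1 : 1 ≤ L := le_trans (by norm_num) hL
  intro j hj z μ hbox
  obtain ⟨h1, h2⟩ := ends_inBox_tilde_of_bondBox_subset_tcube hL1 aC M ρ hj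
    (bondBox_subset_tcube_of_subset_cubeFam hL aC M hρ1 ((Nat.sub_le j 1).trans hj) hbox)
  rw [HalvingP1FlatCoreSupplierInduction.mulCfg_one_right, B8Ineq132.avgIter_one, Pi.one_apply, Pi.one_apply, Units.val_one]
  have h := htw (k - j) (Nat.sub_le _ _) z μ h1 h2
  rw [Nat.sub_sub_self hj] at h
  exact h.le

/-- ★★★ **THE TOP-STEP ROWS OF ONE SITE FROM THE SOCKETS, EDITION γ** — see the module docstring: ✓p678434 `topRows_of_datum_traceFree_γ` at N05's cube member of record, class
`cubeLamBP'`, Theorem 4's clause `H59Dβm` in place of `SockB9P3`, the datum with its support clause; member laws, flat (1.33), (1.35) in the γ guard, (1.66)₀, boundary layer and `hrep`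
discharged; conclusion = ✓p654110's eight conjuncts, unchanged.
[cite: Balaban1985RegularSpaces, Prop. 5 (1.106)-(1.109) p.94, Thm 4 p.88, (1.4)-(1.6) p.77, (1.31) p.82, p.76, (1.131)-(1.133) p.99; Balaban1985BackgroundPropagators, Thm 3.1 p.397, (3.25) p.394, Thm 3.3 p.399; Balaban1985Averaging, p.20, (208)-(214) p.50] -/
theorem siteTopRows_of_sockets_γ (τ : 𝔸 →L[ℂ] ℂ) (hτtr : ∀ x y : 𝔸, τ (x * y) = τ (y * x)) (hd2 : 2 ≤ P.d) (hL : 2 ≤ P.L) {η : ℝ} (hη : 0 < η)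
    -- the groups of the joint J-SU: `G` (averaging-closed, unitary; the flat background is `G`-valued) `≤ H` (values of `u₁`; (H2), (H3)) — at `M₂(ℂ)`: `SU(2) ≤ SL(2, ℂ)` by lit ✓`B8SpecialLinearTrace`
    {G H : Subgroup 𝔸ˣ} (hGrp2 : ∀ g ∈ H, ‖(g : 𝔸) - 1‖ ≤ 1 / 8 → τ (mlog (g : 𝔸)) = 0) (hGrp3 : ∀ S : 𝔸, τ S = 0 → expUnit S ∈ H)
    (hGA : AvgClosed P.d P.L G) (hGH : G ≤ H) (hGu : G ≤ unitaryUnits 𝔸)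
    -- the site, N05's cube member OF RECORD `Ω_j := □_j = cubeFam false L a M′ ρ′ (m+1) j` with its tower families (lit `B8CubeMemberZd`; defining equations, callers write `rfl`), level `k = m + 1 ≥ 2`
    (x₀ : Literature.MathematicalPhysics.QuantumFieldTheory.Balaban1983to89.Site P 0) {a : Site P.d} {M' ρ' : ℕ} (hρ' : P.L ≤ ρ')
    {m : ℕ} (hm1 : 1 ≤ m) (hmP : m + 1 ≤ P.m + P.K)
    (ha : ∀ ν, a ν ≤ ((iterBlockOf (m + 1) x₀ ν).val : ℤ) ∧ ((iterBlockOf (m + 1) x₀ ν).val : ℤ) ≤ a ν + M' - 1)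
    (hroomW : 2 * (P.L ^ (m + 1) * (M' + 1) + ρ' * gs P.L (m + 1)) ≤ P.sitesPerDir 0)
    {Ω : ℕ → Set (Site P.d)} (hΩdef : Ω = cubeFam false P.L a M' ρ' (m + 1))
    {Λs : ℕ → ℕ → Set (Site P.d)} (hΛsdef : Λs = cubeLamS P.L a M' ρ' (m + 1))
    {Λb : ℕ → ℕ → Set (Site P.d × Fin P.d)} (hΛbdef : Λb = cubeLamBP' P.L a M' ρ' (m + 1))
    -- the socket's antecedents: constants, (1.33), (1.34), (1.35)/(1.66) for the pre-gauged field `U′` at the flat background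
    {α₀ α₁ B₀ B₀' cs α₄ : ℝ} (hα₀ : 0 < α₀) (hα₁ : 0 < α₁) (hB₀ : 0 < B₀) (hB₀' : 0 < B₀')
    (hcs : cs = 5 * (P.d : ℝ) * P.L * B₀ * (α₀ + α₁)) (hα₄ : α₄ = 8 * B₀' * (5 * (P.d : ℝ) * P.L * B₀) * (α₀ + α₁))
    {U' : Site P.d → Fin P.d → 𝔸ˣ} (hU' : ∀ x κ, U' x κ ∈ unitaryUnits 𝔸)
    -- J3's pre-gauge rows for `U′` (currency of ✓`HalvingP1FlatCoreSupplierInduction` §1: (1.34)-𝔄 on `ℤᵈ`, axial at the flat background for every family, fine near-1 at every depth on the tilde-cube)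
    (hInAk : InAk P.L (m + 1) η α₀ (fun _ => (Set.univ : Set (Site P.d))) U')
    (hAxJ : ∀ m', m' ≤ m + 1 → ∀ Λ : ℕ → Set (Site P.d), InAx P.L m' Λ (1 : Site P.d → Fin P.d → 𝔸ˣ) U')
    (htw : ∀ m', m' ≤ m + 1 → ∀ (x : Site P.d) (ν : Fin P.d), tlo P.L (tLo a ρ') m' ≤ x → x + e ν ≤ thi P.L (tHi a M' ρ') m' →
      ‖((avgIter P.L U' (m + 1 - m') x ν : 𝔸ˣ) : 𝔸) - 1‖ < α₁)
    -- the datum at level `m`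
    {u₁ : Site P.d → 𝔸ˣ} {U₁ : Site P.d → Fin P.d → 𝔸ˣ} {A : Site P.d → Fin P.d → 𝔸}
    (hu₁ : ∀ x, u₁ x ∈ unitaryUnits 𝔸) (hu₁H : ∀ x, u₁ x ∈ H) (hu₁S : ∀ x, x ∉ Ω 0 → u₁ x = 1)
    (hW : mgauge (1 : Site P.d → Fin P.d → 𝔸ˣ) u₁ U₁ = U') (h129 : Restr129 P.L m (Λs m) (1 : Site P.d → Fin P.d → 𝔸ˣ) u₁)
    (hLan : IsLandau138W P.L m η (Ω 0) (Λs m) (1 : Site P.d → Fin P.d → 𝔸ˣ) U₁)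
    (hdat : ∀ j, j ≤ m → ∀ b ∈ {b : Site P.d × Fin P.d | SideTouches (Ω j) b.1 b.2},
      U₁ b.1 b.2 = cfgExp η A b.1 b.2 ∧ IsSelfAdjoint (A b.1 b.2) ∧ ‖A b.1 b.2‖ ≤ cs * ((P.L : ℝ) ^ j * η)⁻¹)
    (hAτ : ∀ j, j ≤ m → ∀ b ∈ {b : Site P.d × Fin P.d | SideTouches (Ω j) b.1 b.2}, τ (A b.1 b.2) = 0)
    -- the exterior-collar constant with its absorption window, and Theorem 4's own TWO-member (1.59) clause for the datum at the flat background, β-shaped index over PRINT's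
    -- split class ∪ the level-0 crossing bonds of `□₀`, WITH THE EXTERIOR-COLLAR ALLOWANCE ([4] Thm 3.3 for `G(1)`; at `U₀ = 1` = lit's flat (1.59) at the cube member)
    {Bbd : ℝ} (hBbd : 0 ≤ Bbd) (hBd : 4 * Bbd ≤ ((P.d : ℝ) * P.L - 1) * B₀)
    (H59Dβm : ∀ A' : Site P.d → Fin P.d → 𝔸, (∀ y τ, IsSelfAdjoint (A' y τ)) →
      (∀ j, j ≤ m → ∀ (y : Site P.d) (τ : Fin P.d), SideTouches (Ω j) y τ →
        U₁ y τ = cfgExp η A' y τ ∧ ‖A' y τ‖ ≤ cs * ((P.L : ℝ) ^ j * η)⁻¹) →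
      (∀ (y : Site P.d) (τ : Fin P.d), (∀ j, j ≤ m → ¬ SideTouches (Ω j) y τ) → A' y τ = 0) →
      msup P.L m η (-(1 : ℝ)) (fun j (b : Site P.d × Fin P.d) => SideTouches (Ω j) b.1 b.2) (fun b => A' b.1 b.2)
          ≤ B₀ * (bondNorm P.L m η (-(3 : ℝ)) Ω (fun x μ => Jcur η (1 : Site P.d → Fin P.d → 𝔸ˣ) A' μ x)
            + wsup 1 (fun p : {p : ℕ × (Site P.d × Fin P.d) // p.1 ≤ m ∧ (p.2 ∈ Λb m p.1 ∨ (p.1 = 0 ∧ CrossB (Ω 0) p.2))} =>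
                linCovIter P.L (1 : Site P.d → Fin P.d → 𝔸ˣ) (iEta η A') p.1.1 p.1.2.1 p.1.2.2))
            + Bbd * msup P.L m η (-(1 : ℝ)) (fun j (b : Site P.d × Fin P.d) => j = 0 ∧ SideTouches (Ω 0) b.1 b.2 ∧ ¬ BondTouches (Ω 0) b.1 b.2)
                (fun b => A' b.1 b.2) ∧
        msup P.L m η (-(2 : ℝ)) (fun j (t : Fin P.d × Fin P.d × Site P.d) => SideTouches (Ω j) t.2.2 t.2.1)
            (fun t => covDerivFwd η (1 : Site P.d → Fin P.d → 𝔸ˣ) t.1 (fun z => A' z t.2.1) t.2.2)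
          ≤ B₀ * (bondNorm P.L m η (-(3 : ℝ)) Ω (fun x μ => Jcur η (1 : Site P.d → Fin P.d → 𝔸ˣ) A' μ x)
            + wsup 1 (fun p : {p : ℕ × (Site P.d × Fin P.d) // p.1 ≤ m ∧ (p.2 ∈ Λb m p.1 ∨ (p.1 = 0 ∧ CrossB (Ω 0) p.2))} =>
                linCovIter P.L (1 : Site P.d → Fin P.d → 𝔸ˣ) (iEta η A') p.1.1 p.1.2.1 p.1.2.2))
            + Bbd * msup P.L m η (-(1 : ℝ)) (fun j (b : Site P.d × Fin P.d) => j = 0 ∧ SideTouches (Ω 0) b.1 b.2 ∧ ¬ BondTouches (Ω 0) b.1 b.2)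
                (fun b => A' b.1 b.2))
    -- Proposition 3's windows at `(α₀, α₂ := c⋆)` not implied by the JOIN's
    {C₂ : ℝ} (hside : 36 * P.d * B₀ * cs ≤ 1 / 2)
    (hC₂ : 8 * (131072 * ((P.d : ℝ) + 1) ^ 2) * Real.exp (4 * (800 * ((P.d : ℝ) + 1) ^ 2 * ((P.d : ℝ) + 4)) * ((P.L : ℝ) ^ 2 * α₀)) * (P.L : ℝ) ^ 2 ≤ C₂)
    (h61 : 2 * cs ^ 2 + 20 * P.d * α₀ * cs + 2 * C₂ * cs ^ 2 ≤ α₀ + α₁) (hsmall₁ : (P.d : ℝ) * P.L * α₁ ≤ 1 / 8)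
    -- EDITION γ: [3] Prop. 4's windows ONE LEVEL LOWER, at `(L²α₀, L·c⋆)`
    (hα3γ : C0 P.d * ((P.L : ℝ) ^ 2 * α₀) ≤ 1 / 3) (hα4γ : 4 * ((P.L : ℝ) ^ 2 * α₀) ≤ c2' P.d P.L) (h16γ : 16 * ((P.L : ℝ) * cs) ≤ 1)
    (hsmallγ : Real.exp (4 * (800 * ((P.d : ℝ) + 1) ^ 2 * ((P.d : ℝ) + 4)) * ((P.L : ℝ) ^ 2 * α₀))
      * (1 + 8 * (131072 * ((P.d : ℝ) + 1) ^ 2) * ((P.L : ℝ) * cs)) ≤ 2)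
    (hc₃γ : 2 * ((P.L : ℝ) * cs) ≤ c3 P.d P.L)
    -- the [4] LETTERS at `(m + 1, U₀ := 1)` AS ONE PACKAGE: lit `SockLettersRD`'s body at `(α₀, U₀ := 1, n := m + 1)` ∧ the letters' `τ`-compatibility (lit `LettersTau`'s three fields) — junction «(K-sock-τ)»
    {B₀'H B₂' BG BR : ℝ} (hB₀'H : 0 < B₀'H) (hB₂' : 0 ≤ B₂') (hBG : 0 ≤ BG) (hBR : 0 ≤ BR)
    (SLetτ : ∃ (g Δ : (Site P.d → 𝔸) →ₗ[ℂ] (Site P.d → 𝔸)) (q : (Site P.d → 𝔸) →ₗ[ℂ] (ℕ → Site P.d → 𝔸))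
        (qs : (ℕ → Site P.d → 𝔸) →ₗ[ℂ] (Site P.d → 𝔸)) (Aw c : (ℕ → Site P.d → 𝔸) →ₗ[ℂ] (ℕ → Site P.d → 𝔸)) (H' : XSpace P.d (m + 1) 𝔸 →ₗ[ℂ] (Site P.d → 𝔸)),
      (∀ x, ∀ y ∈ Ω 0, (Δ (g x) + qs (Aw (q (g x)))) y = x y) ∧ (∀ f, q (g (g (qs (c (q f))))) = q f) ∧
      (∀ (f : Site P.d → 𝔸), ∀ x ∈ Ω 0, Δ f x = covLap η (1 : Site P.d → Fin P.d → 𝔸ˣ) ((Ω 0).indicator f) x) ∧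
      (∀ (μ : ℕ → Site P.d → 𝔸), ∀ x ∈ Ω 0, qs μ x = QT P.L (m + 1) (Λs (m + 1)) (1 : Site P.d → Fin P.d → 𝔸ˣ) μ x) ∧
      (∀ (f : Site P.d → 𝔸) (j : ℕ), j ≤ m + 1 → ∀ y ∈ Λs (m + 1) j, q f j y = QprimeIter (zdBlocking P.d P.L) (bgT P.L (1 : Site P.d → Fin P.d → 𝔸ˣ)) j f y) ∧
      (∀ (X : XSpace P.d (m + 1) 𝔸) (x : Site P.d), ‖H' X x‖ ≤ B₀'H * ‖X‖) ∧
      (∀ j, j ≤ m + 1 → ∀ (X : XSpace P.d (m + 1) 𝔸), ∀ p ∈ {b : Site P.d × Fin P.d | SideTouches (Ω j) b.1 b.2},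
        wt P.L η j * ‖covDerivFwd η (1 : Site P.d → Fin P.d → 𝔸ˣ) p.2 (H' X) p.1‖ ≤ B₀'H * ‖X‖) ∧
      (∀ X : XSpace P.d (m + 1) 𝔸, Bd2 P.L η (m + 1) Ω (covLap η (1 : Site P.d → Fin P.d → 𝔸ˣ) (H' X)) (B₂' * ‖X‖)) ∧
      (∀ (X : XSpace P.d (m + 1) 𝔸) (x : Site P.d), x ∉ Ω 0 → H' X x = 0) ∧
      (∀ X Y : XSpace P.d (m + 1) 𝔸, (∀ p, Y p = -star (X p)) → ∀ x, H' Y x = -star (H' X x)) ∧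
      (∀ (Y : XSpace P.d (m + 1) 𝔸) (j : ℕ) (hj : j ≤ m + 1) (y : Site P.d), y ∈ Λs (m + 1) j →
        QprimeIter (zdBlocking P.d P.L) (bgT P.L (1 : Site P.d → Fin P.d → 𝔸ˣ)) j (H' Y) y = Y (⟨j, Nat.lt_succ_of_le hj⟩, y)) ∧
      (∀ (f : Site P.d → 𝔸) (r : ℝ), 0 ≤ r → Bd2 P.L η (m + 1) Ω f r →
        (∀ x, ‖g f x‖ ≤ BG * r) ∧ ∀ j, j ≤ m + 1 → ∀ p ∈ {b : Site P.d × Fin P.d | SideTouches (Ω j) b.1 b.2},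
          wt P.L η j * ‖covDerivFwd η (1 : Site P.d → Fin P.d → 𝔸ˣ) p.2 (g f) p.1‖ ≤ BG * r) ∧
      (∀ (f : Site P.d → 𝔸) (x : Site P.d), x ∉ Ω 0 → g f x = 0) ∧
      (∀ f : Site P.d → 𝔸, (∀ j, j ≤ m + 1 → ∀ x ∈ Ω j, IsSelfAdjoint (f x)) → ∀ x, IsSelfAdjoint (g f x)) ∧
      (∀ (f : Site P.d → 𝔸) (r : ℝ), 0 ≤ r → Bd2 P.L η (m + 1) Ω f r → Bd2 P.L η (m + 1) Ω (f - g (qs (c (q (g f))))) (BR * r)) ∧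
      (∀ f : Site P.d → 𝔸, (∀ j, j ≤ m + 1 → ∀ x ∈ Ω j, IsSelfAdjoint (f x)) → ∀ j, j ≤ m + 1 → ∀ x ∈ Ω j, IsSelfAdjoint ((f - g (qs (c (q (g f))))) x)) ∧
      (∀ X : XSpace P.d (m + 1) 𝔸, (∀ p, τ (X p) = 0) → ∀ x, τ (H' X x) = 0) ∧
      (∀ f : Site P.d → 𝔸, (∀ j, j ≤ m + 1 → ∀ x ∈ Ω j, τ (f x) = 0) → ∀ x, τ (g f x) = 0) ∧
      (∀ f : Site P.d → 𝔸, (∀ j, j ≤ m + 1 → ∀ x ∈ Ω j, τ (f x) = 0) → ∀ j, j ≤ m + 1 → ∀ x ∈ Ω j, τ ((f - g (qs (c (q (g f))))) x) = 0))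
    -- the JOIN's scalar windows (the lower family's, N05's letters; `cB cA cDA` free above their datum values)
    {cB cA cDA : ℝ} (hcBlo : P.L * cs ≤ cB) (hcAlo : P.L * cs ≤ cA) (hcDAlo : (P.d : ℝ) * (P.L : ℝ) ^ 2 * cs ≤ cDA)
    (hα3 : C0 P.d * α₀ ≤ 1 / 3) (hα4 : 4 * α₀ ≤ c2' P.d P.L)
    (hsmall : Real.exp (4 * (800 * ((P.d : ℝ) + 1) ^ 2 * ((P.d : ℝ) + 4)) * α₀) * (1 + 8 * (131072 * ((P.d : ℝ) + 1) ^ 2) * cB) ≤ 2)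
    (hc₃ : 2 * cB ≤ c3 P.d P.L) (hsc : 2048 * (P.d : ℝ) * cB ≤ 1) (hα₃' : 40 * P.d * cB ≤ 1 / 200)
    (hs₁ : 200 * C6 P.d * (2 * α₄) ≤ 1) (hs₂ : 12000 * ((P.d : ℝ) + 1) * P.L * (2 * α₄) ≤ 1)
    (hs₃ : C4G P.d P.L * (α₀ + 40 * P.d * cB + 4 * (2 * α₄)) ≤ 1)
    (hs₄ : 1024 * ((P.d : ℝ) + 1) * ((P.d : ℝ) + 4) * P.L ^ 2 * α₀ ≤ 1) (hs₅ : 32 * ((P.d : ℝ) + 1) ^ 2 * C6 P.d * P.L ^ 2 * α₀ ≤ 1)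
    (hs₆ : 16 * P.d * C5' P.d * C6 P.d * (P.L : ℝ) ^ 2 * α₀ ≤ 1) (hs₇ : 8 * P.d * C6 P.d * P.L * α₀ ≤ 1)
    (hprod8 : 2 * C6 P.d * (40 * P.d * cB + 4 * α₄) ≤ 1 / 8) (hcA' : cA ≤ 1 / 13)
    -- the family constants of the top step: above the lower family's; the top member's are the torus windows' business
    {Cb Cl : ℝ} (hCblo : C2p P.d * (40 * P.d * cB + α₄) * α₄ ≤ Cb) (hCllo : 2 * C2p P.d * (40 * P.d * cB + 2 * α₄) ≤ Cl)
    (hCbρ : Cb ≤ α₄ / (2 * B₀'H)) (hClB : Cl * B₀'H ≤ 1 / 2)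
    -- (D) the torus side: the effective-gauge tower of the charted iterate, the representative, the target (✓p636261's letters VERBATIM at `k := m + 1`)
    (W₁ : GaugeField P 0 𝔸ˣ) (κf : (Literature.MathematicalPhysics.QuantumFieldTheory.Balaban1983to89.Site P 0 → 𝔸) → (i : ℕ) → GaugeTransf P i 𝔸ˣ)
    (th : XSpace P.d (m + 1) 𝔸) (hτ : B₀'H * ‖th‖ < α₄ / 4) (hth : ∀ p, star (th p) = -th p)
    (hthk : ∀ yc ∈ Λs (m + 1) (m + 1), th (⟨m + 1, Nat.lt_succ_self (m + 1)⟩, yc) = mlog ((axialT (dbarIterU (m + 1) W₁) (iterBlockOf (m + 1) x₀) (coverAt P (m + 1) yc) : 𝔸ˣ) : 𝔸))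
    (hthlo : ∀ (j : ℕ) (hj : j < m + 1) (y : Site P.d), y ∈ Λs (m + 1) j → th (⟨j, Nat.lt_succ_of_lt hj⟩, y) = 0)
    (haxT : ∀ yc ∈ Λs (m + 1) (m + 1), ‖((axialT (dbarIterU (m + 1) W₁) (iterBlockOf (m + 1) x₀) (coverAt P (m + 1) yc) : 𝔸ˣ) : 𝔸) - 1‖ < 1)
    -- the top-step windows at the Sect. E sizes (✓p636261's letters VERBATIM, `B₀' := B₀'H`)
    (ha₁' : α₄ / 4 + B₀'H * (Cb + ‖th‖) ≤ 1 / 24) (hb₁' : α₄ / 4 + B₀'H * (Cb + ‖th‖) ≤ 1 / 140)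
    (hθ : 10 * (α₄ / 4 + B₀'H * (Cb + ‖th‖)) * BR ≤ 1 / 2) (hh₀' : B₀'H * (Cb + ‖th‖) ≤ 3 * α₄ / 4)
    (h103 : BG * Mc P.d BR (α₄ / 4 + B₀'H * (Cb + ‖th‖)) cA (B₂' * (Cb + ‖th‖)) cDA ≤ α₄ / 4)
    (h106 : BG * Kc P.d BR (α₄ / 4 + B₀'H * (Cb + ‖th‖)) cA (B₂' * (Cb + ‖th‖)) cDA (B₂' * (2 * Cl)) (1 + B₀'H * (2 * Cl)) (1 + B₀'H * (2 * Cl))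
      ≤ 1 / 2)
    -- (E) the three top rows in torus letters on the tower box (✓p636261's letters VERBATIM at `k := m + 1`)
    (hTop121 : ∀ yc ∈ Λs (m + 1) (m + 1), ∀ l₀ : Literature.MathematicalPhysics.QuantumFieldTheory.Balaban1983to89.Site P 0 → 𝔸,
      (∀ x : Site P.d, InBox (tlo P.L yc (m + 1)) (thi P.L yc (m + 1)) x → ‖l₀ (cover P x)‖ ≤ α₄) →
      (∀ (x : Site P.d) (κ : Fin P.d), InBox (tlo P.L yc (m + 1)) (thi P.L yc (m + 1)) x → InBox (tlo P.L yc (m + 1)) (thi P.L yc (m + 1)) (x + e κ) →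
        ‖l₀ (cover P (x + e κ)) - l₀ (cover P x)‖ ≤ α₄ * ((P.L : ℝ) ^ (m + 1))⁻¹) →
      exp (mlog ((κf l₀ (m + 1) (coverAt P (m + 1) yc) : 𝔸ˣ) : 𝔸)) = ((κf l₀ (m + 1) (coverAt P (m + 1) yc) : 𝔸ˣ) : 𝔸) ∧
        ‖mlog ((κf l₀ (m + 1) (coverAt P (m + 1) yc) : 𝔸ˣ) : 𝔸) - siteAvgIter (m + 1) l₀ (coverAt P (m + 1) yc)‖ ≤ Cb)
    (hTop125 : ∀ yc ∈ Λs (m + 1) (m + 1), ∀ (l₁ l₂ : Literature.MathematicalPhysics.QuantumFieldTheory.Balaban1983to89.Site P 0 → 𝔸) (r : ℝ), 0 ≤ r →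
      (∀ x : Site P.d, InBox (tlo P.L yc (m + 1)) (thi P.L yc (m + 1)) x → ‖l₁ (cover P x)‖ ≤ α₄) →
      (∀ (x : Site P.d) (κ : Fin P.d), InBox (tlo P.L yc (m + 1)) (thi P.L yc (m + 1)) x → InBox (tlo P.L yc (m + 1)) (thi P.L yc (m + 1)) (x + e κ) →
        ‖l₁ (cover P (x + e κ)) - l₁ (cover P x)‖ ≤ α₄ * ((P.L : ℝ) ^ (m + 1))⁻¹) →
      (∀ x : Site P.d, InBox (tlo P.L yc (m + 1)) (thi P.L yc (m + 1)) x → ‖l₂ (cover P x)‖ ≤ α₄) →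
      (∀ (x : Site P.d) (κ : Fin P.d), InBox (tlo P.L yc (m + 1)) (thi P.L yc (m + 1)) x → InBox (tlo P.L yc (m + 1)) (thi P.L yc (m + 1)) (x + e κ) →
        ‖l₂ (cover P (x + e κ)) - l₂ (cover P x)‖ ≤ α₄ * ((P.L : ℝ) ^ (m + 1))⁻¹) →
      (∀ x : Site P.d, InBox (tlo P.L yc (m + 1)) (thi P.L yc (m + 1)) x → ‖l₁ (cover P x) - l₂ (cover P x)‖ ≤ r) →
      (∀ (x : Site P.d) (κ : Fin P.d), InBox (tlo P.L yc (m + 1)) (thi P.L yc (m + 1)) x → InBox (tlo P.L yc (m + 1)) (thi P.L yc (m + 1)) (x + e κ) →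
        ‖(l₁ (cover P (x + e κ)) - l₂ (cover P (x + e κ))) - (l₁ (cover P x) - l₂ (cover P x))‖ ≤ r * ((P.L : ℝ) ^ (m + 1))⁻¹) →
      ‖(mlog ((κf l₁ (m + 1) (coverAt P (m + 1) yc) : 𝔸ˣ) : 𝔸) - siteAvgIter (m + 1) l₁ (coverAt P (m + 1) yc)) -
          (mlog ((κf l₂ (m + 1) (coverAt P (m + 1) yc) : 𝔸ˣ) : 𝔸) - siteAvgIter (m + 1) l₂ (coverAt P (m + 1) yc))‖ ≤ Cl * r)
    (hTopReal : ∀ yc ∈ Λs (m + 1) (m + 1), ∀ l₀ : Literature.MathematicalPhysics.QuantumFieldTheory.Balaban1983to89.Site P 0 → 𝔸,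
      (∀ x : Site P.d, InBox (tlo P.L yc (m + 1)) (thi P.L yc (m + 1)) x → ‖l₀ (cover P x)‖ ≤ α₄) →
      (∀ (x : Site P.d) (κ : Fin P.d), InBox (tlo P.L yc (m + 1)) (thi P.L yc (m + 1)) x → InBox (tlo P.L yc (m + 1)) (thi P.L yc (m + 1)) (x + e κ) →
        ‖l₀ (cover P (x + e κ)) - l₀ (cover P x)‖ ≤ α₄ * ((P.L : ℝ) ^ (m + 1))⁻¹) →
      mlog ((κf (fun s => -star (l₀ s)) (m + 1) (coverAt P (m + 1) yc) : 𝔸ˣ) : 𝔸) - siteAvgIter (m + 1) (fun s => -star (l₀ s)) (coverAt P (m + 1) yc) =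
        -star (mlog ((κf l₀ (m + 1) (coverAt P (m + 1) yc) : 𝔸ˣ) : 𝔸) - siteAvgIter (m + 1) l₀ (coverAt P (m + 1) yc)))
    -- (τ) the torus τ-rows of (τ-3): the target and the top member (suppliers ✓`…TopTargetTrace`, ✓`…TopRowsTrace`)
    (hthτ : ∀ p, τ (th p) = 0)
    (hTopTrace : ∀ yc ∈ Λs (m + 1) (m + 1), ∀ l₀ : Literature.MathematicalPhysics.QuantumFieldTheory.Balaban1983to89.Site P 0 → 𝔸, (∀ s, τ (l₀ s) = 0) →
      (∀ x : Site P.d, InBox (tlo P.L yc (m + 1)) (thi P.L yc (m + 1)) x → ‖l₀ (cover P x)‖ ≤ α₄) →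
      (∀ (x : Site P.d) (κ : Fin P.d), InBox (tlo P.L yc (m + 1)) (thi P.L yc (m + 1)) x → InBox (tlo P.L yc (m + 1)) (thi P.L yc (m + 1)) (x + e κ) →
        ‖l₀ (cover P (x + e κ)) - l₀ (cover P x)‖ ≤ α₄ * ((P.L : ℝ) ^ (m + 1))⁻¹) →
      τ (mlog ((κf l₀ (m + 1) (coverAt P (m + 1) yc) : 𝔸ˣ) : 𝔸) - siteAvgIter (m + 1) l₀ (coverAt P (m + 1) yc)) = 0) :
    ∃ lam : Site P.d → 𝔸, (∀ x, IsSelfAdjoint (lam x)) ∧ (∀ x, x ∉ Ω 0 → lam x = 0) ∧ (∀ x, τ (lam x) = 0) ∧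
      (∀ j, j ≤ m + 1 → ∀ b ∈ {b : Site P.d × Fin P.d | SideTouches (Ω j) b.1 b.2},
        ‖lam b.1‖ ≤ α₄ ∧ wt P.L η j * ‖covDerivFwd η (1 : Site P.d → Fin P.d → 𝔸ˣ) b.2 lam b.1‖ ≤ α₄) ∧
      (∃ μ : ℕ → Site P.d → 𝔸, ∀ x ∈ Ω 0,
        covLap η (1 : Site P.d → Fin P.d → 𝔸ˣ) ((Ω 0).indicator fun y =>
          covDivB η (1 : Site P.d → Fin P.d → 𝔸ˣ) A y + covLap η (1 : Site P.d → Fin P.d → 𝔸ˣ) lam y +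
          ((conjR (gaugeExp lam y)⁻¹ (covDivB η (1 : Site P.d → Fin P.d → 𝔸ˣ) A y) - covDivB η (1 : Site P.d → Fin P.d → 𝔸ˣ) A y) +
            (gAd (covLap η (1 : Site P.d → Fin P.d → 𝔸ˣ) lam y) (lam y) - covLap η (1 : Site P.d → Fin P.d → 𝔸ˣ) lam y) +
            ∑ μ, frakF3 η (1 : Site P.d → Fin P.d → 𝔸ˣ) lam A y μ)) x = QT P.L (m + 1) (Λs (m + 1)) (1 : Site P.d → Fin P.d → 𝔸ˣ) μ x) ∧
      (∀ j, j < m + 1 → ∀ y ∈ Λs (m + 1) j,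
        Qnl P.L (1 : Site P.d → Fin P.d → 𝔸ˣ) (fun x => expUnit (((-I) • lam) x)) u₁⁻¹ j y = 0) ∧
      (∀ yc ∈ Λs (m + 1) (m + 1), κf (((-I) • lam) ∘ fun s : Literature.MathematicalPhysics.QuantumFieldTheory.Balaban1983to89.Site P 0 => lift P x₀ + rel x₀ s) (m + 1) (coverAt P (m + 1) yc) = axialT (dbarIterU (m + 1) W₁) (iterBlockOf (m + 1) x₀) (coverAt P (m + 1) yc)) ∧
      (∀ x ∈ Ω 0, ∀ μ : Fin P.d,
        wt P.L η 0 * ‖A x μ‖ ≤ cA ∧ wt P.L η 0 * ‖conjR ((1 : Site P.d → Fin P.d → 𝔸ˣ) (x - e μ) μ)⁻¹ (A (x - e μ) μ)‖ ≤ cA) := by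
  subst hΩdef hΛsdef hΛbdef
  have hL1 : 1 ≤ P.L := le_trans (by norm_num) hL
  have hρ'1 : 1 ≤ ρ' := hL1.trans hρ'
  -- the member geometry (lit `B8CubeMemberZd` ∕ `B8SockHFPCubeMember`, BY NAME)
  have hΩ := hΩ_cubeFam (d := P.d) hL1 a M' hρ' (m + 1)
  have hbox := cubeLamBP'_hbox_pred (d := P.d) hL1 a M' hρ' (m + 1)
  have hclass := cubeLamBP'_hclass (d := P.d) hL1 a M' hρ' (m + 1)
  have hlay := bdryLayer_cubeMember (d := P.d) hL a M' ρ' (m + 1) hρ' (by omega)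
  have htower := htw_cubeLamS (d := P.d) hL1 a M' ρ' (m + 1) (m + 1) le_rfl
  have hlt := h8lt_cubeLamS (d := P.d) P.L a M' ρ' (m + 1) m (lt_add_one m)
  have htop := h8top_cubeLamS (d := P.d) hL1 a M' ρ' (m + 1) m (lt_add_one m)
  -- the pre-gauged field's rows at the flat background: (1.33) of `1`, (1.34)∕(Ax)∕(1.35) from J3's currency (✓p647600 §1)
  have h33 : InAk P.L (m + 1) η α₀ (cubeFam false P.L a M' ρ' (m + 1)) (1 : Site P.d → Fin P.d → 𝔸ˣ) := one_inAk hL1 (m + 1) hη hα₀ _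
  have h34 := h34_of_inAk_univ hInAk (cubeFam false P.L a M' ρ' (m + 1))
  have hAx := hAx_of_inAx_one hAxJ (cubeLamS P.L a M' ρ' (m + 1))
  have h135 := h135_cubeMember_γ (𝔸 := 𝔸) hL a M' hρ'1 htw
  -- (1.66)₀ on the sides touching `□₀`, read off the tower row at depth `m + 1` (`Ū⁰ = U′`) on the collar `□̃`
  have h66 : ∀ b ∈ {b : Site P.d × Fin P.d | SideTouches (cubeFam false P.L a M' ρ' (m + 1) 0) b.1 b.2}, ‖((U' b.1 b.2 : 𝔸ˣ) : 𝔸) - 1‖ ≤ α₁ := by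
    intro b hb
    have hb' : SideTouches (cubeFam false P.L a M' ρ' (m + 1) 0) b.1 b.2 := hb
    rw [cubeFam_false_of_le P.L a M' ρ' (Nat.zero_le (m + 1))] at hb'
    obtain ⟨h1, h2⟩ := ends_of_sideTouches (collar_cube hL hρ'1 (Nat.zero_le (m + 1))) hb'
    have h := htw (m + 1) le_rfl b.1 b.2 h1 h2
    rw [Nat.sub_self, B7Prop2Explicit.avgIter_zero] at h
    exact h.le
  -- the representative law on the top tower boxes (✓p642293)
  have hrep := hrep_cubeLamS (P := P) hmP x₀ ha hroomW
  -- the letters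
  obtain ⟨g, Δ, q, qs, Aw, c, H', g_rightΩ, c_range, hΔ, hqs, hq, hH0, hH1, hH2, hHsupp, hHequiv, hQH, hG, hGsupp, hGreal, hRbd, hRreal, hHτ, hGτ, hRτ⟩ := SLetτ
  -- THE CALL (✓p648920, BY NAME)
  exact topRows_of_datum_traceFree_γ (P := P) τ hτtr hd2 hL hη (K₀ := m + 1) hGrp2 hGrp3 hGA hGH hGu
    hΩ hbox hclass hm1 (lt_add_one m) hmP htower hlt htop hα₀ hα₁ hB₀ hB₀' hcs hα₄ hU' h33 h34 hAx h135 h66 hlay hBbd hBd hu₁ hu₁H hu₁S hW h129 hLan hdat hAτ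
    H59Dβm hside hC₂ h61 hsmall₁ hα3γ hα4γ h16γ hsmallγ hc₃γ
    g Δ q qs Aw c g_rightΩ c_range hΔ hqs hq H' hB₀'H hB₂' hBG hBR hH0 hH1 hH2 hHsupp hHequiv hQH hG hGsupp hGreal hRbd hRreal hHτ hGτ hRτ
    hcBlo hcAlo hcDAlo hα3 hα4 hsmall hc₃ hsc hα₃' hs₁ hs₂ hs₃ hs₄ hs₅ hs₆ hs₇ hprod8 hcA' hCblo hCllo hCbρ hClB W₁ κf
    (fun s => lift P x₀ + rel x₀ s) hrep (iterBlockOf (m + 1) x₀) th hτ hth hthk hthlo haxT ha₁' hb₁' hθ hh₀' h103 h106 hTop121 hTop125 hTopReal hthτ hTopTrace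

end Summit.QuantumFields.YangMills.Theorems.HalvingHSiteTopRowsOfSocketsGamma

end
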